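import Literature.NumberTheory.EllipticCurves.RingClassFieldInertia
import Literature.NumberTheory.EllipticCurves.HuShuYin2019.SylvesterPairAdditivePlaces
import Literature.NumberTheory.DiophantineGeometry.LocalReductionFiniteBadPlacesProofs
import Literature.NumberTheory.DiophantineGeometry.LocalReductionProofs
import HarnessLib

/-!
# The Sylvester pair `(E_{3p²}, E_p)` over `K = ℚ(ω)`: good reduction away from `3p` (including the
# places above `2`), and the CM-frame Kolyvagin classes are Selmer there

Topic `NumberTheory/EllipticCurves/HuShuYin2019`; namespace
`Literature.NumberTheory.EllipticCurves.HuShuYin2019`. Theorems only: **no definition, no named fact**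
(D-0026). Companion of `SylvesterPairAdditivePlaces` (the additive places `v ∣ 3p`) and of
`RingClassFieldInertia` (inertia at the unramified places of the tower field).

* §1 **Good reduction of `E_n : y² = x³ − 432n²` over a number field `K` at every finite `w ∤ 3n`, for
  `n` an ODD integer** — including the places `w ∣ 2`, where the given equation is not minimal: the
  change of variables `(u, r, s, t) = (2, 0, 0, 4)` yields the `w`-integral model
  `y² + y = x³ − (27n² + 1)/4` of discriminant `−3⁹n⁴` (for `n = 1`: Cremona `27a1`,
  `y² + y = x³ − 7`), a `w`-unit; Silverman VII.1 Rem. 1.1 / VII.5 Prop. 5.1 (tree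
  `hasGoodReductionAt_of_valuation_le_one_of_valuation_Δ_eq_one`) and isomorphism invariance
  (`hasGoodReductionAt_smul_iff_holds`).  Specialisations `B = E_p`, `A = E_{3p²}` (`p ≠ 2, 3`):
  good reduction at every `w ∤ 3p` (`hasGoodReductionAt_cubeSumCurve_prime_baseChange`,
  `hasGoodReductionAt_cubeSumCurve_three_mul_sq_baseChange`).
* §2 **(L1) of the coupled descent at the good places.**  For the CM-frame classes of the recipe
  `HuShuYin2019.exists_cmFrame_kolyvaginClass` (tower field `K[m]` embedded by `emb`, `N = Gal(K̄/emb K[m])`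
  by `hN`, transport `ψ` with `N` fixing the cube root `v`, `Q ∈ E_9(K̄)^N`): Kolyvagin's class of `ψ Q`
  on `E' = (E_b)_K`, `b` odd, satisfies the Selmer local condition at every finite `w ∤ 3bm`
  (`kolyvaginClass_cmFrame_mem_selmerLocalKer_of_not_mem`; `B`: `…_cubeSumCurve_prime_…`, `A`:
  `…_cubeSumCurve_three_mul_sq_…`) — §1 and `JZero.kolyvaginClass_cubicTwist_mem_selmerLocalKer_of_ringClassField`
  (Gross Prop. 6.2 (1) via Milne I.3.8).  With `SylvesterPairAdditivePlaces` (places `w ∣ 3p`) and the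
  tree's `mem_selmerLocalKer_infinitePlace_of_isImaginaryQuadratic` (places `∞`) these are the off-level
  local conditions of leaf (L1) of `Summit…SylvesterTwoCoupledDescentAtTwo.selmerGroup_eq_bot_and_le_closure_of_coupledLeaves`
  for the crux `UpperOffV0HSYPlus` (stmt-BirchSwinnertonDyer-19804), cell memo MEMO-bsd-cm-two §57.3
  «LOCAL BEHAVIOUR OFF n» («`v ∤ 6pn`: K[9pn]/K unramified, good reduction ⇒ finite = unramified
  condition»; «`v = 2`: good reduction at 2 over K, K[9pn]/K unramified at 2 — standard»).

Nothing is asserted about the Selmer groups beyond these memberships; BSD is not claimed.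

## References

* [SilvermanAEC2009] J. H. Silverman, *The Arithmetic of Elliptic Curves*, 2nd ed. (2009), III.1
  (change of variables), VII.1 Rem. 1.1, VII.5 Prop. 5.1, VIII.1 Rem. 1.3.
* [HuShuYin2019] Y. Hu, J. Shu, H. Yin, *An explicit Gross–Zagier formula related to the Sylvester
  conjecture*, Trans. AMS 372 (2019), §1 p. 4 (`E_n : y² = x³ − 432n²`), §2.
* [GrossLMS1991] B. H. Gross, *Kolyvagin's work on modular elliptic curves* (1991), Prop. 6.2 (1).
* [Cox2013] D. A. Cox, *Primes of the form x² + ny²*, 2nd ed. (2013), §9.A (p. 181).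
-/

noncomputable section

open scoped Classical NumberField

open NumberField IsDedekindDomain WeierstrassCurve

namespace Literature.NumberTheory.EllipticCurves.HuShuYin2019

open Literature.NumberTheory.GaloisRepresentations KolyvaginCocycle

variable {K : Type} [Field K] [NumberField K]

/-! ## §1 Good reduction of `(E_n)_K` at `w ∤ 3n` (`n` odd), including `w ∣ 2` -/

/-- The change of variables `(u, r, s, t) = (2, 0, 0, 4)` takes `E_n : y² = x³ − 432n²` to
`y² + y = x³ − (27n² + 1)/4`. [cite: SilvermanAEC2009, III.1 (Table 3.1)] -/
theorem variableChange_two_smul_cubeSumCurve (n : ℚ) :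
    (⟨Units.mk0 (2 : ℚ) two_ne_zero, 0, 0, 4⟩ : VariableChange ℚ) • cubeSumCurve n =
      ⟨0, 0, 1, 0, -(27 * n ^ 2 + 1) / 4⟩ := by
  ext
  · simp [cubeSumCurve, variableChange_a₁]
  · simp [cubeSumCurve, variableChange_a₂]
  · simp [cubeSumCurve, variableChange_a₃]
    norm_num
  · simp [cubeSumCurve, variableChange_a₄]
  · simp [cubeSumCurve, variableChange_a₆]
    norm_num
    ring

/-- The discriminant of `y² + y = x³ + a` is `−27(1 + 4a)²`; for `a = −(27n² + 1)/4` it is `−3⁹n⁴`.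
[cite: SilvermanAEC2009, III.1 (b₂, b₄, b₆, b₈, Δ)] -/
theorem Δ_variableChange_two_smul_cubeSumCurve (n : ℚ) :
    ((⟨0, 0, 1, 0, -(27 * n ^ 2 + 1) / 4⟩ : WeierstrassCurve ℚ)).Δ = -(3 ^ 9 * n ^ 4) := by
  simp only [WeierstrassCurve.Δ, WeierstrassCurve.b₂, WeierstrassCurve.b₄, WeierstrassCurve.b₆,
    WeierstrassCurve.b₈]
  ring

/-- **`(E_n)_K` has good reduction at every finite place `w ∤ 3n` when `n` is an odd integer**
(in particular at the places above `2`): the model `y² + y = x³ − (27n² + 1)/4` is `w`-integral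
with unit discriminant `−3⁹n⁴`. [cite: SilvermanAEC2009, VII.5 Prop. 5.1 (a) with VII.1 Rem. 1.1
and VIII.1 Rem. 1.3] [cite: HuShuYin2019, §1 p. 4] -/
theorem hasGoodReductionAt_cubeSumCurve_baseChange_of_odd {q : ℚ} {N : ℤ} (hq : q = N)
    (hN : Odd N) (w : HeightOneSpectrum (𝓞 K)) (h3w : ((3 : ℕ) : 𝓞 K) ∉ w.asIdeal)
    (hNw : ((N : ℤ) : 𝓞 K) ∉ w.asIdeal) :
    ((cubeSumCurve q).baseChange K).HasGoodReductionAt w := by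
  subst hq
  obtain ⟨m, rfl⟩ := hN
  set C : VariableChange ℚ := ⟨Units.mk0 (2 : ℚ) two_ne_zero, 0, 0, 4⟩ with hC
  have hbc : (C • cubeSumCurve ((2 * m + 1 : ℤ) : ℚ)).baseChange K =
      (C.map (algebraMap ℚ K)) • (cubeSumCurve ((2 * m + 1 : ℤ) : ℚ)).baseChange K := by
    rw [WeierstrassCurve.baseChange, WeierstrassCurve.baseChange, WeierstrassCurve.map_variableChange]
  refine (hasGoodReductionAt_smul_iff_holds w _ (C.map (algebraMap ℚ K))).mp ?_
  rw [← hbc, hC, variableChange_two_smul_cubeSumCurve]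
  have hcoe : ∀ z : ℤ, algebraMap ℚ K (z : ℚ) = algebraMap (𝓞 K) K (z : 𝓞 K) := fun z ↦ by
    rw [map_intCast, map_intCast]
  have ha₆ : (-(27 * (((2 * m + 1 : ℤ)) : ℚ) ^ 2 + 1) / 4 : ℚ) =
      ((-(27 * m ^ 2 + 27 * m + 7) : ℤ) : ℚ) := by
    push_cast
    ring
  have hΔ : ((⟨0, 0, 1, 0, -(27 * (((2 * m + 1 : ℤ)) : ℚ) ^ 2 + 1) / 4⟩ : WeierstrassCurve ℚ)).Δ =
      ((-(3 ^ 9 * (2 * m + 1) ^ 4) : ℤ) : ℚ) := by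
    rw [Δ_variableChange_two_smul_cubeSumCurve]
    push_cast
    ring
  refine hasGoodReductionAt_of_valuation_le_one_of_valuation_Δ_eq_one w _ ?_ ?_ ?_ ?_ ?_ ?_
  · simp [WeierstrassCurve.baseChange]
  · simp [WeierstrassCurve.baseChange]
  · simp [WeierstrassCurve.baseChange]
  · simp [WeierstrassCurve.baseChange]
  · rw [WeierstrassCurve.baseChange, WeierstrassCurve.map_a₆, ha₆, hcoe]
    exact w.valuation_le_one _
  · rw [WeierstrassCurve.baseChange, WeierstrassCurve.map_Δ, hΔ, hcoe,
      HeightOneSpectrum.valuation_eq_one_iff_notMem]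
    intro hmem
    have e : -((((-(3 ^ 9 * (2 * m + 1) ^ 4) : ℤ)) : 𝓞 K)) =
        (3 : 𝓞 K) ^ 9 * ((((2 * m + 1 : ℤ)) : 𝓞 K)) ^ 4 := by
      push_cast
      ring
    have hmem' := w.asIdeal.neg_mem hmem
    rw [e] at hmem'
    rcases w.isPrime.mem_or_mem hmem' with h | h
    · exact h3w (by simpa using w.isPrime.mem_of_pow_mem 9 h)
    · exact hNw (w.isPrime.mem_of_pow_mem 4 h)

/-- `B = E_p` over `K` has good reduction at every finite `w ∤ 3p` (`p ≠ 2` prime), in particular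
above `2`. [cite: SilvermanAEC2009, VII.5 Prop. 5.1 (a), VIII.1 Rem. 1.3] [cite: HuShuYin2019, §1 p. 4] -/
theorem hasGoodReductionAt_cubeSumCurve_prime_baseChange {p : ℕ} (hp : p.Prime) (hp2 : p ≠ 2)
    (w : HeightOneSpectrum (𝓞 K)) (h3w : ((3 : ℕ) : 𝓞 K) ∉ w.asIdeal)
    (hpw : ((p : ℕ) : 𝓞 K) ∉ w.asIdeal) :
    ((cubeSumCurve (p : ℚ)).baseChange K).HasGoodReductionAt w :=
  hasGoodReductionAt_cubeSumCurve_baseChange_of_odd (N := p) (by norm_cast)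
    (by exact_mod_cast hp.odd_of_ne_two hp2) w h3w (by exact_mod_cast hpw)

/-- `A = E_{3p²}` over `K` has good reduction at every finite `w ∤ 3p` (`p ≠ 2` prime), in
particular above `2`. [cite: SilvermanAEC2009, VII.5 Prop. 5.1 (a), VIII.1 Rem. 1.3] [cite: HuShuYin2019, §1 p. 4] -/
theorem hasGoodReductionAt_cubeSumCurve_three_mul_sq_baseChange {p : ℕ} (hp : p.Prime) (hp2 : p ≠ 2)
    (w : HeightOneSpectrum (𝓞 K)) (h3w : ((3 : ℕ) : 𝓞 K) ∉ w.asIdeal)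
    (hpw : ((p : ℕ) : 𝓞 K) ∉ w.asIdeal) :
    ((cubeSumCurve (3 * (p : ℚ) ^ 2)).baseChange K).HasGoodReductionAt w := by
  refine hasGoodReductionAt_cubeSumCurve_baseChange_of_odd (N := 3 * p ^ 2) (by push_cast; ring)
    ((by decide : Odd (3 : ℤ)).mul ((by exact_mod_cast hp.odd_of_ne_two hp2 : Odd (p : ℤ)).pow))
    w h3w fun h ↦ ?_
  push_cast at h
  rcases w.isPrime.mem_or_mem h with h3 | hp'
  · exact h3w (by simpa using h3)
  · exact hpw (w.isPrime.mem_of_pow_mem 2 hp')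

/-! ## §2 The CM-frame Kolyvagin classes are Selmer at the good places `w ∤ 3bm` -/

/-- **(L1) at the good places, general odd `b`.**  For `K` imaginary quadratic (`K = ℚ(ω)`), the
tower field `K[m]` embedded by `emb` with `N = Gal(K̄/emb K[m])` (`hN`), the CM-frame transport
`ψ : E_9(K̄) ≃ E_b(K̄)` with `N` fixing its cube root `v`, a point `Q ∈ E_9(K̄)^N`, and Kolyvagin's
class `c(ψ Q) ∈ H¹(K, E_b[n])` of the recipe `exists_cmFrame_kolyvaginClass`: at every finite place
`w ∤ 3bm` (`b` an odd integer) the class satisfies the Selmer local condition — good reduction (§1)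
and unramified local inertia inside `N` (`RingClassFieldInertia`).
[cite: GrossLMS1991, Prop. 6.2 (1)] [cite: Cox2013, §9.A (p. 181)] [cite: HuShuYin2019, §2 p. 8] -/
theorem kolyvaginClass_cmFrame_mem_selmerLocalKer_of_not_mem (hK : IsImaginaryQuadratic K)
    (ιK : K →+* ℂ) {m : ℕ} (hm : m ≠ 0) (emb : ringClassField K ιK m →+* AlgebraicClosure K)
    (hemb : ∀ k : K, emb (algebraMap K (ringClassField K ιK m) k) = algebraMap K (AlgebraicClosure K) k)
    (N : Subgroup (Field.absoluteGaloisGroup K))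
    (hN : ∀ g, g ∈ N ↔ ∀ x : ringClassField K ιK m,
      (show AlgebraicClosure K ≃ₐ[K] AlgebraicClosure K from g) (emb x) = emb x)
    {b : ℚ} {B : ℤ} (hb : b = B) (hB : Odd B) {v : AlgebraicClosure K}
    {ψ : geomPoints ((cubeSumCurve 9).baseChange K) ≃+ geomPoints ((cubeSumCurve b).baseChange K)}
    (hψ : ∀ {x y : AlgebraicClosure K}
        (h : (((cubeSumCurve 9).baseChange K).baseChange (AlgebraicClosure K)).toAffine.Nonsingular x y),
        ∃ h', ψ (Affine.Point.some x y h) = Affine.Point.some (v ^ 2 * x) (v ^ 3 * y) h')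
    (hNv : ∀ h ∈ N, (show AlgebraicClosure K ≃ₐ[K] AlgebraicClosure K from h) v = v)
    {A : AddSubgroup (geomPoints ((cubeSumCurve b).baseChange K))} {n : ℤ}
    {hdiv : ∀ P : geomPoints ((cubeSumCurve b).baseChange K),
      ∃ R : geomPoints ((cubeSumCurve b).baseChange K), n • R = P}
    (hA : IsAdmissible (Field.absoluteGaloisGroup K) A n)
    {Q : geomPoints ((cubeSumCurve 9).baseChange K)}
    (hQN : Q ∈ FixedPoints.addSubgroup N (geomPoints ((cubeSumCurve 9).baseChange K)))
    (hQ' : ψ Q ∈ invPoints (Field.absoluteGaloisGroup K) A n)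
    (w : HeightOneSpectrum (𝓞 K)) (h3w : ((3 : ℕ) : 𝓞 K) ∉ w.asIdeal)
    (hBw : ((B : ℤ) : 𝓞 K) ∉ w.asIdeal) (hmw : ((m : ℕ) : 𝓞 K) ∉ w.asIdeal) :
    kolyvaginClass ((cubeSumCurve b).baseChange K) n hdiv hA (ψ Q) hQ' ∈
      selmerLocalKer ((cubeSumCurve b).baseChange K) (w.adicCompletion K) n := by
  have hB0 : B ≠ 0 := by
    obtain ⟨k, rfl⟩ := hB
    omega
  have hb0 : b ≠ 0 := by
    rw [hb]
    exact_mod_cast hB0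
  haveI := isElliptic_cubeSumCurve_baseChange K hb0
  exact JZero.kolyvaginClass_cubicTwist_mem_selmerLocalKer_of_ringClassField hK ιK hm emb hemb N hN
    hψ hNv hA hQN hQ' w hmw (hasGoodReductionAt_cubeSumCurve_baseChange_of_odd hb hB w h3w hBw)

/-- **(L1) at the good places for `B = E_p`**: the CM-frame class of `ψ Q` on `(E_p)_K` satisfies the
Selmer local condition at every finite `w ∤ 3pm` (`p ≠ 2` prime; `m` the conductor of the tower
field, printed `9pn`). [cite: GrossLMS1991, Prop. 6.2 (1)] [cite: Cox2013, §9.A (p. 181)] [cite: HuShuYin2019, §2 p. 8] -/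
theorem kolyvaginClass_cmFrame_cubeSumCurve_prime_mem_selmerLocalKer (hK : IsImaginaryQuadratic K)
    (ιK : K →+* ℂ) {m : ℕ} (hm : m ≠ 0) (emb : ringClassField K ιK m →+* AlgebraicClosure K)
    (hemb : ∀ k : K, emb (algebraMap K (ringClassField K ιK m) k) = algebraMap K (AlgebraicClosure K) k)
    (N : Subgroup (Field.absoluteGaloisGroup K))
    (hN : ∀ g, g ∈ N ↔ ∀ x : ringClassField K ιK m,
      (show AlgebraicClosure K ≃ₐ[K] AlgebraicClosure K from g) (emb x) = emb x)
    {p : ℕ} (hp : p.Prime) (hp2 : p ≠ 2) {v : AlgebraicClosure K}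
    {ψ : geomPoints ((cubeSumCurve 9).baseChange K) ≃+
      geomPoints ((cubeSumCurve (p : ℚ)).baseChange K)}
    (hψ : ∀ {x y : AlgebraicClosure K}
        (h : (((cubeSumCurve 9).baseChange K).baseChange (AlgebraicClosure K)).toAffine.Nonsingular x y),
        ∃ h', ψ (Affine.Point.some x y h) = Affine.Point.some (v ^ 2 * x) (v ^ 3 * y) h')
    (hNv : ∀ h ∈ N, (show AlgebraicClosure K ≃ₐ[K] AlgebraicClosure K from h) v = v)
    {A : AddSubgroup (geomPoints ((cubeSumCurve (p : ℚ)).baseChange K))} {n : ℤ}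
    {hdiv : ∀ P : geomPoints ((cubeSumCurve (p : ℚ)).baseChange K),
      ∃ R : geomPoints ((cubeSumCurve (p : ℚ)).baseChange K), n • R = P}
    (hA : IsAdmissible (Field.absoluteGaloisGroup K) A n)
    {Q : geomPoints ((cubeSumCurve 9).baseChange K)}
    (hQN : Q ∈ FixedPoints.addSubgroup N (geomPoints ((cubeSumCurve 9).baseChange K)))
    (hQ' : ψ Q ∈ invPoints (Field.absoluteGaloisGroup K) A n)
    (w : HeightOneSpectrum (𝓞 K)) (h3w : ((3 : ℕ) : 𝓞 K) ∉ w.asIdeal)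
    (hpw : ((p : ℕ) : 𝓞 K) ∉ w.asIdeal) (hmw : ((m : ℕ) : 𝓞 K) ∉ w.asIdeal) :
    kolyvaginClass ((cubeSumCurve (p : ℚ)).baseChange K) n hdiv hA (ψ Q) hQ' ∈
      selmerLocalKer ((cubeSumCurve (p : ℚ)).baseChange K) (w.adicCompletion K) n :=
  kolyvaginClass_cmFrame_mem_selmerLocalKer_of_not_mem hK ιK hm emb hemb N hN (B := p)
    (by norm_cast) (by exact_mod_cast hp.odd_of_ne_two hp2) hψ hNv hA hQN hQ' w h3w
    (by exact_mod_cast hpw) hmw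

/-- **(L1) at the good places for `A = E_{3p²}`**: the CM-frame class of `ψ Q` on `(E_{3p²})_K`
satisfies the Selmer local condition at every finite `w ∤ 3pm` (`p ≠ 2` prime).
[cite: GrossLMS1991, Prop. 6.2 (1)] [cite: Cox2013, §9.A (p. 181)] [cite: HuShuYin2019, §2 p. 8] -/
theorem kolyvaginClass_cmFrame_cubeSumCurve_three_mul_sq_mem_selmerLocalKer
    (hK : IsImaginaryQuadratic K) (ιK : K →+* ℂ) {m : ℕ} (hm : m ≠ 0)
    (emb : ringClassField K ιK m →+* AlgebraicClosure K)
    (hemb : ∀ k : K, emb (algebraMap K (ringClassField K ιK m) k) = algebraMap K (AlgebraicClosure K) k)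
    (N : Subgroup (Field.absoluteGaloisGroup K))
    (hN : ∀ g, g ∈ N ↔ ∀ x : ringClassField K ιK m,
      (show AlgebraicClosure K ≃ₐ[K] AlgebraicClosure K from g) (emb x) = emb x)
    {p : ℕ} (hp : p.Prime) (hp2 : p ≠ 2) {v : AlgebraicClosure K}
    {ψ : geomPoints ((cubeSumCurve 9).baseChange K) ≃+
      geomPoints ((cubeSumCurve (3 * (p : ℚ) ^ 2)).baseChange K)}
    (hψ : ∀ {x y : AlgebraicClosure K}
        (h : (((cubeSumCurve 9).baseChange K).baseChange (AlgebraicClosure K)).toAffine.Nonsingular x y),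
        ∃ h', ψ (Affine.Point.some x y h) = Affine.Point.some (v ^ 2 * x) (v ^ 3 * y) h')
    (hNv : ∀ h ∈ N, (show AlgebraicClosure K ≃ₐ[K] AlgebraicClosure K from h) v = v)
    {A : AddSubgroup (geomPoints ((cubeSumCurve (3 * (p : ℚ) ^ 2)).baseChange K))} {n : ℤ}
    {hdiv : ∀ P : geomPoints ((cubeSumCurve (3 * (p : ℚ) ^ 2)).baseChange K),
      ∃ R : geomPoints ((cubeSumCurve (3 * (p : ℚ) ^ 2)).baseChange K), n • R = P}
    (hA : IsAdmissible (Field.absoluteGaloisGroup K) A n)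
    {Q : geomPoints ((cubeSumCurve 9).baseChange K)}
    (hQN : Q ∈ FixedPoints.addSubgroup N (geomPoints ((cubeSumCurve 9).baseChange K)))
    (hQ' : ψ Q ∈ invPoints (Field.absoluteGaloisGroup K) A n)
    (w : HeightOneSpectrum (𝓞 K)) (h3w : ((3 : ℕ) : 𝓞 K) ∉ w.asIdeal)
    (hpw : ((p : ℕ) : 𝓞 K) ∉ w.asIdeal) (hmw : ((m : ℕ) : 𝓞 K) ∉ w.asIdeal) :
    kolyvaginClass ((cubeSumCurve (3 * (p : ℚ) ^ 2)).baseChange K) n hdiv hA (ψ Q) hQ' ∈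
      selmerLocalKer ((cubeSumCurve (3 * (p : ℚ) ^ 2)).baseChange K) (w.adicCompletion K) n := by
  refine kolyvaginClass_cmFrame_mem_selmerLocalKer_of_not_mem hK ιK hm emb hemb N hN (B := 3 * p ^ 2)
    (by push_cast; ring)
    ((by decide : Odd (3 : ℤ)).mul ((by exact_mod_cast hp.odd_of_ne_two hp2 : Odd (p : ℤ)).pow))
    hψ hNv hA hQN hQ' w h3w (fun h ↦ ?_) hmw
  push_cast at h
  rcases w.isPrime.mem_or_mem h with h3 | hp'
  · exact h3w (by simpa using h3)
  · exact hpw (w.isPrime.mem_of_pow_mem 2 hp')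

end Literature.NumberTheory.EllipticCurves.HuShuYin2019
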